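import Mathlib.Combinatorics.SimpleGraph.Connectivity.Finite
import Literature.Probability.LatticeModels.LoopO1
import Literature.Combinatorics.SimpleGraph.CycleSpaceSeparators
import HarnessLib

/-!
# `stub_threeClean` — the three clean pairing events are disjoint inside `𝒯_A`

Support file for the line `Sketch` of the crux `StrandShadow` (stmt-CriticalPhenomena-14626), route
`FKParityRobustness`, sub-problem `Ising3DConformalLimit`.  Pure finite-graph combinatorics, fully
proved.

For four vertices `a : Fin 4 → V` of a finite simple graph `G`, a real `t ≥ 0` and the family
`𝒯_A = tJoins G univ (image a)` of edge sets `F ⊆ E(G)` whose odd-degree set is exactly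
`A = {a 0, a 1, a 2, a 3}`, the three *clean pairing events*

* the `F`-cluster of `a 0` contains neither `a 2` nor `a 3`,
* the `F`-cluster of `a 0` contains neither `a 1` nor `a 3`,
* the `F`-cluster of `a 0` contains neither `a 1` nor `a 2`

are pairwise disjoint sub-families of `𝒯_A`: a member of two of them would leave `a 0` joined inside
`F` to none of `a 1, a 2, a 3`, contradicting the handshake lemma in the `F`-component of `a 0`
(`exists_reachable_odd_of_odd`: a vertex of odd `F`-degree is joined to ANOTHER vertex of odd
`F`-degree, and the odd-degree vertices of `F ∈ 𝒯_A` are exactly the `a j`).  Since the weights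
`t ^ |F|` are nonnegative, the three restricted sums add up to at most `Z(A) = Σ_{F ∈ 𝒯_A} t ^ |F|`.
No injectivity of `a` is needed (if `a j = a 0` the event "`a 0` does not reach `a j`" is empty).

Contents: `exists_source_reachable_of_mem_tJoins_image` (handshake bookkeeping, modelled on
`reachable_of_mem_tJoins_pair` of `FKParityRobustnessShadowGivesJoin`), `not_avoid_three_sources`,
the elementary `sum_filter_add_sum_filter_add_sum_filter_le`, and `stub_threeClean` (statement
verbatim from the lead's skeleton of line `Sketch`).

References: U. T. Hansen, J. Jiang, F. R. Klausen, arXiv:2506.10765, §2 (sourced even subgraphs)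
[HansenJiangKlausen2025]; the handshake lemma [folklore].
-/

noncomputable section

open Finset SimpleGraph
open Literature.Probability.LatticeModels
open Literature.Combinatorics.SimpleGraph.CycleSpace

namespace Summit.CriticalPhenomena.Ising3DConformalLimit.Theorems.StrandShadowSketch

open scoped Classical

/-! ## Handshake bookkeeping for `T`-joins with an indexed source set -/

section General

variable {V : Type*} [Fintype V] [DecidableEq V] (G : SimpleGraph V) [DecidableRel G.Adj]

/-- **A source of a `T`-join is joined to another source.**  If `∂F` is the image of `a` then,
inside `F`, the source `a i` reaches some source `a j ≠ a i` (handshake in the `F`-component of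
`a i`, `exists_reachable_odd_of_odd`; the edges of `F ⊆ E(G)` are not loops). -/
theorem exists_source_reachable_of_mem_tJoins_image {ω : Set (Sym2 V)} {ι : Type*} [Fintype ι]
    (a : ι → V) (i : ι) {F : Finset (Sym2 V)} (hF : F ∈ tJoins G ω (Finset.univ.image a)) :
    ∃ j, a j ≠ a i ∧ (fromEdgeSet (↑F : Set (Sym2 V))).Reachable (a i) (a j) := by
  -- adapted from `reachable_of_mem_tJoins_pair` (Theorems/FKParityRobustnessShadowGivesJoin.lean)
  obtain ⟨hFG, -, hpar⟩ := (mem_tJoins G).1 hF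
  have hFE : ∀ e ∈ F, ¬ e.IsDiag := fun e he =>
    G.not_isDiag_of_mem_edgeSet (mem_edgeFinset.1 (hFG he))
  have hx : Odd (edgeDeg F (a i)) :=
    (hpar (a i)).2 (Finset.mem_image_of_mem a (Finset.mem_univ i))
  obtain ⟨w, hw, hreach, hwodd⟩ := exists_reachable_odd_of_odd F hFE hx
  obtain ⟨j, -, rfl⟩ := Finset.mem_image.1 ((hpar w).1 hwodd)
  exact ⟨j, hw, hreach⟩

/-- **Four sources: `a 0` cannot avoid all three others.**  In a `T`-join `F` with
`∂F = {a 0, a 1, a 2, a 3}` the cluster of `a 0` contains at least one of `a 1`, `a 2`, `a 3`. -/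
theorem not_avoid_three_sources {ω : Set (Sym2 V)} (a : Fin 4 → V) {F : Finset (Sym2 V)}
    (hF : F ∈ tJoins G ω (Finset.univ.image a))
    (h1 : ¬ (fromEdgeSet (↑F : Set (Sym2 V))).Reachable (a 0) (a 1))
    (h2 : ¬ (fromEdgeSet (↑F : Set (Sym2 V))).Reachable (a 0) (a 2))
    (h3 : ¬ (fromEdgeSet (↑F : Set (Sym2 V))).Reachable (a 0) (a 3)) : False := by
  obtain ⟨j, hj, hreach⟩ := exists_source_reachable_of_mem_tJoins_image G a 0 hF
  fin_cases j
  · exact hj rfl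
  · exact h1 hreach
  · exact h2 hreach
  · exact h3 hreach

end General

/-! ## Three disjoint filtered sub-sums -/

/-- Three filtered sub-sums of a sum of nonnegative reals, over pairwise incompatible predicates,
add up to at most the whole sum. -/
theorem sum_filter_add_sum_filter_add_sum_filter_le {ι : Type*} (s : Finset ι) (f : ι → ℝ)
    (p q r : ι → Prop) [DecidablePred p] [DecidablePred q] [DecidablePred r]
    (hpq : ∀ i ∈ s, p i → ¬ q i) (hpr : ∀ i ∈ s, p i → ¬ r i) (hqr : ∀ i ∈ s, q i → ¬ r i)
    (hf : ∀ i ∈ s, 0 ≤ f i) :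
    ∑ i ∈ s.filter p, f i + ∑ i ∈ s.filter q, f i + ∑ i ∈ s.filter r, f i ≤ ∑ i ∈ s, f i := by
  rw [← Finset.sum_union (Finset.disjoint_filter.2 hpq),
    ← Finset.sum_union (Finset.disjoint_union_left.2
      ⟨Finset.disjoint_filter.2 hpr, Finset.disjoint_filter.2 hqr⟩)]
  exact Finset.sum_le_sum_of_subset_of_nonneg
    (Finset.union_subset (Finset.union_subset (Finset.filter_subset _ _)
      (Finset.filter_subset _ _)) (Finset.filter_subset _ _))
    fun i hi _ => hf i hi

/-! ## The stub -/

/-- **stub_threeClean** — inside `𝒯_A` the three clean pairing events ("the `a₀`-cluster reaches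
neither of the other two sources") are pairwise disjoint (handshake in the `a₀`-component), so
for `t ≥ 0` their weights add up to at most `Z(A) = Σ_{F ∈ 𝒯_A} t^{|F|}`. -/
theorem stub_threeClean :
    ∀ (V : Type) [Fintype V] [DecidableEq V] (G : SimpleGraph V) [DecidableRel G.Adj] (t : ℝ),
      0 ≤ t → ∀ a : Fin 4 → V,
      (∑ F ∈ (tJoins G Set.univ (Finset.univ.image a)).filter (fun F : Finset (Sym2 V) =>
            ¬ (SimpleGraph.fromEdgeSet (↑F : Set (Sym2 V))).Reachable (a 0) (a 2) ∧
            ¬ (SimpleGraph.fromEdgeSet (↑F : Set (Sym2 V))).Reachable (a 0) (a 3)), t ^ F.card) +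
      (∑ F ∈ (tJoins G Set.univ (Finset.univ.image a)).filter (fun F : Finset (Sym2 V) =>
            ¬ (SimpleGraph.fromEdgeSet (↑F : Set (Sym2 V))).Reachable (a 0) (a 1) ∧
            ¬ (SimpleGraph.fromEdgeSet (↑F : Set (Sym2 V))).Reachable (a 0) (a 3)), t ^ F.card) +
      (∑ F ∈ (tJoins G Set.univ (Finset.univ.image a)).filter (fun F : Finset (Sym2 V) =>
            ¬ (SimpleGraph.fromEdgeSet (↑F : Set (Sym2 V))).Reachable (a 0) (a 1) ∧
            ¬ (SimpleGraph.fromEdgeSet (↑F : Set (Sym2 V))).Reachable (a 0) (a 2)), t ^ F.card)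
        ≤ ∑ F ∈ tJoins G Set.univ (Finset.univ.image a), t ^ F.card := by
  intro V _ _ G _ t ht a
  refine sum_filter_add_sum_filter_add_sum_filter_le _ _ _ _ _ ?_ ?_ ?_ fun F _ => pow_nonneg ht _
  · exact fun F hF hP hQ => not_avoid_three_sources G a hF hQ.1 hP.1 hP.2
  · exact fun F hF hP hQ => not_avoid_three_sources G a hF hQ.1 hQ.2 hP.2
  · exact fun F hF hP hQ => not_avoid_three_sources G a hF hP.1 hQ.2 hP.2

end Summit.CriticalPhenomena.Ising3DConformalLimit.Theorems.StrandShadowSketch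

end
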